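import Summits.RiemannHypothesis.RiemannHypothesis.Theorems.GroundBartaPolarPerronFrobeniusSourceCriterion
import Summits.RiemannHypothesis.RiemannHypothesis.Theorems.GroundBartaPolarPerronFrobeniusSmallWindows
import Summits.RiemannHypothesis.RiemannHypothesis.Theorems.GroundBartaPolarPerronFrobeniusOfEvenConeDense
import HarnessLib

/-!
# RiemannHypothesis / GroundBarta — crux `PolarPerronFrobenius` (stmt-RiemannHypothesis-18390):
# the source criterion, part S4: SOURCE-POSITIVE EVEN TESTS ⇒ the S1 matrix ⇒ the crux (cofinally)

Helper file (`--supports stmt-RiemannHypothesis-18390`), RH-free, Mathlib + proved tree files only,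
no definitions, no named facts.

Write `S_g(y) = ∫ g⁺(x)w(|x−y|)dx + Σ_{log n<2a} Λ(n)n^{-1/2}(g⁺(y+log n) + g⁺(y−log n))
− 2∫ g⁺(x)cosh((x−y)/2)dx` for the SOURCE of the positive part of a real window test `g` (part S3),
and call `g` SOURCE-POSITIVE if `S_g(y) ≥ 0` at every `y` with `g(y) < 0`.  Part S3 proved: a
source-positive real test is matched, up to any `δ > 0`, by a non-negative (even if `g` is even)
normalised test (`swu_cone_of_source`).  Consequently:

* `swu_evenConeDense_of_sourcePositive`: at a window `a > 0`, if every EVEN real normalised window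
  test is matched up to any `δ > 0` by a SOURCE-POSITIVE even real normalised window test, then the
  matrix of the registered RH-bearing stub `stub_evenConeDense_cofinal` holds at `a` (even cone
  tests are dense among even tests);
* `polarPerronFrobenius_of_cofinal_sourcePositive`: **if this happens at windows beyond every height
  (at the even-winning ones suffices), the crux `PolarPerronFrobenius` follows** (through the landed
  reduction `polarPerronFrobenius_of_evenConeDense_cofinal`, S1 ⇒ crux).

This is the TEST-LEVEL, Euler–Lagrange-free form of the harmonic-majorant line
(`Cruxes/PolarPerronFrobenius/Ideas/harmonic-majorant-edge-source.md`): its RH-strength input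
`SharpBulkShape` is to deliver even real near-minimisers that are non-negative on the bulk and whose
(untruncated) source is positive on the thin edge layer carrying their negative part — i.e. exactly
source-positive near-minimisers; everything downstream of that is now a landed theorem.

Prover B, speedrun unit `sr-gb-rung-b` (seat 2).
-/

set_option linter.dupNamespace false

noncomputable section

open Set MeasureTheory Filter Complex
open scoped Real Topology

namespace Summit.RiemannHypothesis.RiemannHypothesis.Theorems.PolarPerronFrobenius

open Literature.NumberTheory.LFunctions
open Summit.RiemannHypothesis.RiemannHypothesis.Theorems.OddSector
open scoped ArithmeticFunction.vonMangoldt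

/-- **Source-positive even tests dense ⇒ even cone density** (the S1 matrix at the window `a`).
Hypothesis `H a`: every even real `L²`-normalised window test `f` is matched up to any `δ > 0` by an
even real `L²`-normalised window test `g` with `Re Q(g) ≤ Re Q(f) + δ` whose source is `≥ 0` on
`{g < 0}`.  Conclusion: every even normalised window test `h` (complex-valued) is matched up to any
`δ > 0` by an even CONE test. [folklore] -/
theorem swu_evenConeDense_of_sourcePositive {a : ℝ} (ha : 0 < a)
    (H : ∀ f : ℝ → ℝ, IsWeilTest (fun t ↦ ((f t : ℝ) : ℂ)) →
      tsupport (fun t ↦ ((f t : ℝ) : ℂ)) ⊆ Icc (-a) a → (∀ t, f (-t) = f t) →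
      ∫ t, ‖((f t : ℝ) : ℂ)‖ ^ 2 = 1 → ∀ δ : ℝ, 0 < δ →
        ∃ g : ℝ → ℝ, IsWeilTest (fun t ↦ ((g t : ℝ) : ℂ)) ∧
          tsupport (fun t ↦ ((g t : ℝ) : ℂ)) ⊆ Icc (-a) a ∧ (∀ t, g (-t) = g t) ∧
          ∫ t, ‖((g t : ℝ) : ℂ)‖ ^ 2 = 1 ∧
          (weilQuadratic fun t ↦ ((g t : ℝ) : ℂ)).re ≤ (weilQuadratic fun t ↦ ((f t : ℝ) : ℂ)).re + δ ∧
          (∀ y, g y < 0 → 0 ≤ (∫ x, max (g x) 0 * weilArchDensity |x - y|) +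
            (∑ n ∈ weilPrimeIndex a, (Λ n : ℝ) / Real.sqrt n *
              (max (g (y + Real.log n)) 0 + max (g (y - Real.log n)) 0)) -
            2 * ∫ x, max (g x) 0 * Real.cosh ((x - y) / 2))) :
    ∀ h : ℝ → ℂ, IsWeilTest h → tsupport h ⊆ Set.Icc (-a) a → (∀ t, h (-t) = h t) →
      ∫ t, ‖h t‖ ^ 2 = (1 : ℝ) → ∀ δ : ℝ, 0 < δ →
        ∃ w : ℝ → ℂ, IsWeilTest w ∧ tsupport w ⊆ Set.Icc (-a) a ∧ (∀ t, w (-t) = w t) ∧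
          (∀ t, (w t).im = 0 ∧ 0 ≤ (w t).re) ∧ ∫ t, ‖w t‖ ^ 2 = (1 : ℝ) ∧
          (weilQuadratic w).re ≤ (weilQuadratic h).re + δ := by
  -- the real even case, Rayleigh form: from a real even `R` with `0 < ‖R‖²` and `Re Q(R) ≤ ‖R‖² C`
  have hreal : ∀ R : ℝ → ℝ, IsWeilTest (fun t ↦ ((R t : ℝ) : ℂ)) →
      tsupport (fun t ↦ ((R t : ℝ) : ℂ)) ⊆ Icc (-a) a → (∀ t, R (-t) = R t) →
      0 < ∫ t, ‖((R t : ℝ) : ℂ)‖ ^ 2 → ∀ C : ℝ,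
      (weilQuadratic fun t ↦ ((R t : ℝ) : ℂ)).re ≤ (∫ t, ‖((R t : ℝ) : ℂ)‖ ^ 2) * C →
      ∀ δ : ℝ, 0 < δ →
        ∃ w : ℝ → ℂ, IsWeilTest w ∧ tsupport w ⊆ Icc (-a) a ∧ (∀ t, w (-t) = w t) ∧
          (∀ t, (w t).im = 0 ∧ 0 ≤ (w t).re) ∧ ∫ t, ‖w t‖ ^ 2 = 1 ∧ (weilQuadratic w).re ≤ C + δ := by
    intro R hR hRs hRe hN C hQ δ hδ
    -- normalise `R`
    set N : ℝ := ∫ t, ‖((R t : ℝ) : ℂ)‖ ^ 2 with hNdef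
    set c : ℝ := (Real.sqrt N)⁻¹ with hc
    have hcpos : 0 < c := inv_pos.2 (Real.sqrt_pos.2 hN)
    have hcc : c * c = 1 / N := by rw [hc, ← mul_inv, Real.mul_self_sqrt hN.le, one_div]
    have e : (fun t ↦ ((c * R t : ℝ) : ℂ)) = fun t ↦ (c : ℂ) * ((R t : ℝ) : ℂ) := by
      funext t; push_cast; ring
    have hF1 : IsWeilTest fun t ↦ ((c * R t : ℝ) : ℂ) := by rw [e]; exact hR.const_mul c
    have hsupp1 : tsupport (fun t ↦ ((c * R t : ℝ) : ℂ)) ⊆ Icc (-a) a := by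
      rw [e]; exact tsupport_mul_subset_right.trans hRs
    have e' : ∀ t, ((c * R t : ℝ) : ℂ) = (c : ℂ) * ((R t : ℝ) : ℂ) := fun t ↦ by push_cast; ring
    have hnorm1 : ∫ t, ‖((c * R t : ℝ) : ℂ)‖ ^ 2 = 1 := by
      have h1 : ∀ t, ‖((c * R t : ℝ) : ℂ)‖ ^ 2 = c ^ 2 * ‖((R t : ℝ) : ℂ)‖ ^ 2 := fun t ↦ by
        rw [e', norm_mul, mul_pow, Complex.norm_real, Real.norm_of_nonneg hcpos.le]
      simp only [h1]
      rw [integral_const_mul, ← hNdef, hc, inv_pow, Real.sq_sqrt hN.le, inv_mul_cancel₀ hN.ne']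
    have hQ1 : (weilQuadratic fun t ↦ ((c * R t : ℝ) : ℂ)).re ≤ C := by
      rw [e, weilQuadratic_const_mul, Complex.normSq_ofReal, Complex.re_ofReal_mul, hcc, one_div,
        inv_mul_eq_div, div_le_iff₀ hN]
      linarith
    have hfe1 : ∀ t, c * R (-t) = c * R t := fun t ↦ by rw [hRe]
    -- a source-positive even competitor `g`, then the source criterion
    obtain ⟨g, hg, hgs, hge, hgn, hgQ, hsrc⟩ := H (fun t ↦ c * R t) hF1 hsupp1 hfe1 hnorm1 (δ / 2)
      (by linarith)
    have hgc := sw_contDiff_of_isWeilTest_ofReal hg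
    have hgcs := sw_hasCompactSupport_of_isWeilTest_ofReal hg
    have hgsR : tsupport g ⊆ Icc (-a) a := (sw_tsupport_ofReal_comp g) ▸ hgs
    obtain ⟨w, hw, hws, hsign, hwn, hwQ, hwe⟩ :=
      swu_cone_of_source hgc hgcs ha hgsR hgn hsrc (δ := δ / 2) (by linarith)
    exact ⟨w, hw, hws, hwe hge, hsign, hwn, by linarith⟩
  -- the complex even case: split into real and imaginary parts (both even), select one
  intro h hh hsupp hhe hnorm δ hδ
  have hR : IsWeilTest fun t ↦ (((h t).re : ℝ) : ℂ) := isWeilTest_rePart hh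
  have hS : IsWeilTest fun t ↦ (((h t).im : ℝ) : ℂ) := isWeilTest_imPart hh
  have hRs : tsupport (fun t ↦ (((h t).re : ℝ) : ℂ)) ⊆ Icc (-a) a :=
    (tsupport_rePart_subset h).trans hsupp
  have hSs : tsupport (fun t ↦ (((h t).im : ℝ) : ℂ)) ⊆ Icc (-a) a :=
    (tsupport_imPart_subset h).trans hsupp
  have hRe : ∀ t, (h (-t)).re = (h t).re := fun t ↦ by rw [hhe]
  have hSe : ∀ t, (h (-t)).im = (h t).im := fun t ↦ by rw [hhe]
  have hQ := re_weilQuadratic_eq_rePart_add_imPart hh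
  have hNRS : (∫ t, ‖(((h t).re : ℝ) : ℂ)‖ ^ 2) + ∫ t, ‖(((h t).im : ℝ) : ℂ)‖ ^ 2 = 1 := by
    rw [← hnorm]
    exact integral_norm_sq_rePart_add_imPart hh.memLp_two
  have hNR0 : 0 ≤ ∫ t, ‖(((h t).re : ℝ) : ℂ)‖ ^ 2 := integral_nonneg fun t ↦ by positivity
  have hNS0 : 0 ≤ ∫ t, ‖(((h t).im : ℝ) : ℂ)‖ ^ 2 := integral_nonneg fun t ↦ by positivity
  have hx0 : (∫ t, ‖(((h t).re : ℝ) : ℂ)‖ ^ 2) = 0 →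
      (weilQuadratic fun t ↦ (((h t).re : ℝ) : ℂ)).re = 0 := fun h0 ↦ by
    rw [hR.eq_zero_of_integral_norm_sq_eq_zero h0, weilQuadratic_zero, Complex.zero_re]
  have hy0 : (∫ t, ‖(((h t).im : ℝ) : ℂ)‖ ^ 2) = 0 →
      (weilQuadratic fun t ↦ (((h t).im : ℝ) : ℂ)).re = 0 := fun h0 ↦ by
    rw [hS.eq_zero_of_integral_norm_sq_eq_zero h0, weilQuadratic_zero, Complex.zero_re]
  rcases sw_select hNR0 hNS0 hNRS hQ.symm hx0 hy0 with ⟨hN, hle⟩ | ⟨hN, hle⟩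
  · exact hreal _ hR hRs hRe hN _ hle δ hδ
  · exact hreal _ hS hSs hSe hN _ hle δ hδ

/-- **The crux from cofinally dense source-positive even tests.**  If beyond every height there is a
window `a` at which — granted that the even sector carries the bottom there (`EW a`) — every even real
normalised window test is matched up to any `δ > 0` by a SOURCE-POSITIVE even real normalised window
test, then `PolarPerronFrobenius` holds.  (Even cone density from the previous theorem; the crux from
the landed reduction `polarPerronFrobenius_of_evenConeDense_cofinal`, S1 ⇒ crux.)  The hypothesis is
the test-level, Euler–Lagrange-free residue of the harmonic-majorant line: near-minimisers that are
`≥ 0` on the bulk and whose source is `≥ 0` on their thin negative edge layer. [folklore] -/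
theorem polarPerronFrobenius_of_cofinal_sourcePositive
    (hyp : ∀ A : ℝ, ∃ a : ℝ, A ≤ a ∧
      ((∀ o : ℝ → ℂ, IsWeilTest o → tsupport o ⊆ Set.Icc (-a) a →
            (∀ t, o (-t) = -o t) → ∫ t, ‖o t‖ ^ 2 = (1 : ℝ) → ∀ δ : ℝ, 0 < δ →
              ∃ w : ℝ → ℂ, IsWeilTest w ∧ tsupport w ⊆ Set.Icc (-a) a ∧ (∀ t, w (-t) = w t) ∧
                ∫ t, ‖w t‖ ^ 2 = (1 : ℝ) ∧ (weilQuadratic w).re ≤ (weilQuadratic o).re + δ) →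
        ∀ f : ℝ → ℝ, IsWeilTest (fun t ↦ ((f t : ℝ) : ℂ)) →
          tsupport (fun t ↦ ((f t : ℝ) : ℂ)) ⊆ Icc (-a) a → (∀ t, f (-t) = f t) →
          ∫ t, ‖((f t : ℝ) : ℂ)‖ ^ 2 = 1 → ∀ δ : ℝ, 0 < δ →
            ∃ g : ℝ → ℝ, IsWeilTest (fun t ↦ ((g t : ℝ) : ℂ)) ∧
              tsupport (fun t ↦ ((g t : ℝ) : ℂ)) ⊆ Icc (-a) a ∧ (∀ t, g (-t) = g t) ∧
              ∫ t, ‖((g t : ℝ) : ℂ)‖ ^ 2 = 1 ∧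
              (weilQuadratic fun t ↦ ((g t : ℝ) : ℂ)).re ≤
                (weilQuadratic fun t ↦ ((f t : ℝ) : ℂ)).re + δ ∧
              (∀ y, g y < 0 → 0 ≤ (∫ x, max (g x) 0 * weilArchDensity |x - y|) +
                (∑ n ∈ weilPrimeIndex a, (Λ n : ℝ) / Real.sqrt n *
                  (max (g (y + Real.log n)) 0 + max (g (y - Real.log n)) 0)) -
                2 * ∫ x, max (g x) 0 * Real.cosh ((x - y) / 2)))) :
    Summit.RiemannHypothesis.RiemannHypothesis.Theses.GroundBarta.PolarPerronFrobenius := by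
  refine polarPerronFrobenius_of_evenConeDense_cofinal fun A ↦ ?_
  obtain ⟨a, ha, hH⟩ := hyp (max A 1)
  have ha0 : 0 < a := lt_of_lt_of_le one_pos ((le_max_right _ _).trans ha)
  exact ⟨a, (le_max_left _ _).trans ha, fun hEW ↦
    swu_evenConeDense_of_sourcePositive ha0 (hH hEW)⟩

end Summit.RiemannHypothesis.RiemannHypothesis.Theorems.PolarPerronFrobenius

end
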